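import Summits.QuantumFields.YangMills.Theorems.AllWindowsColdBoxBoxHighLineLandauBallCapacityPrelims
import Summits.QuantumFields.YangMills.Theorems.AllWindowsColdBoxBoxHighLinePauliFarRegion

/-!
# J5a′ «single-site far-region coercivity with a LOGARITHM instead of `H⁴`»: on the gauge ball of radius `r` with `r·H² ≤ c₀`,
# `gaugeDist g g' x₀ ≤ C·(1 + log H)⁴ · landauPhi H (U^{g'})` at EVERY site, and `c·‖A x₀‖² ≤ (1 + log H)⁴ · landauPhi H (V^{pauliGauge A})`

Width seat `ym-line-sfw-p2-w2` (prover-ym-line-sfw-p2-w2-g32-0).  Third brick for planner ym-idea-2 g18's recorded lift **L1** of the next rung U5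
(`Cruxes/BoxWindowHighSU2213/U5-BLOCKERS.md` §1 B1): after ✓J2∞/J4∞ (the ℓ² fixed point) the remaining `H¹²` source of the Jacobian assembly
✓`OrbitJacobian.orbitNormaliserJacobianR_of` is the FAR region, which starts at the injectivity radius `a₀ ≍ H⁻²` and is paid by ✓J5a
`farRegionPhiLowerBall : c₅‖A x₀‖² ≤ H⁴·Φ` (the global ℓ²-coercivity ✓4ℓ `landauBallCoercivity` read at one site).  Here the single-site bound is
proved with `(1 + log H)⁴` in place of `H⁴`, under the (stronger, but in-window) radius condition `r·H² ≤ c₀`: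

* ★★ **`landauBallCoercivity_site`** — `∃ c₀ > 0, C ≥ 0`: for `H ≥ 1`, `0 ≤ r`, `r·H² ≤ c₀`, `U^g` Landau, `U^g` and `U^{g'}` in the `r`-ball
  (interior `g, g'`): `gaugeDist g g' x₀ ≤ C·(1 + log H)⁴·landauPhi H (U^{g'})` for EVERY site `x₀`;
* ★★ **`farRegionPhiLowerBall_log`** — the J5a-shaped corollary: `c·‖A x₀‖² ≤ (1 + log H)⁴ · landauPhi H (V^{pauliGauge H A})` for `V` Landau in the
  `r`-ball, `V^{pauliGauge A}` in the `2r`-ball, `‖A x‖ ≤ π`, `r·H² ≤ c₀`.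

PROOF (helpers in the companion ✓`…LandauBallCapacityPrelims`; ✓4ℓ's letters: `h = g'g⁻¹`, `ψ_x = q(h_x)`, `φ = Im ψ`, `F_e = Im q(W_e) − Im q(V_e)`).  LINEARISATION per edge `e = (x → y)`:
`F_e = (φ_x − φ_y) + E_e` with the EXACT identity `Im(x ȳ) = Im x − Im y + Im((x − 1)·(y − x)^*)` (`x x^* = 1`) and ✓`transform_sub_eq`, so
`‖E_e‖ ≤ ‖ψ_x − 1‖·‖ψ_x − ψ_y‖ + r(‖ψ_x − 1‖ + ‖ψ_y − 1‖) ≤ 3r(‖ψ_x − 1‖ + ‖ψ_y − 1‖)` (✓`norm_sub_le_of_transform`: `‖ψ_x − ψ_y‖ ≤ 2r`), whence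
`Σ_e ‖E_e‖² ≤ 144 r²·Σ_x gaugeDist ≤ 144 r² H⁴ Φ / c` by ✓4ℓ ITSELF — this is where `r·H² ≤ c₀` enters and NO `D ≤ 16H²Φ` is needed.
SITE EQUATION: summing `F = ∇φ + E` around an interior site with the Landau condition of `V` (✓`sum_im_su2Quat_eq_of_inLandauGauge`) gives
`(−Δ_D φ)(x) = −L(divDefect W x) − ρ(x)`, `ρ(x) = Σ_μ (E(x,μ) − E(x−e_μ,μ))`, `Σ_x ‖ρ(x)‖² ≤ 16 Σ_e ‖E_e‖²`.
CAPACITY (✓`Capacity.sq_apply_le_mul_normSq_dirichlet`, the bi-Laplacian capacity of a point in `d = 4`, componentwise on `Im ℍ ≅ ℝ³`):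
`‖φ_{x₀}‖² ≤ C_HS (1 + log H)⁴ · Σ_x ‖(−Δ_D φ)(x)‖² ≤ 2 C_HS (1 + log H)⁴ (Φ + Σ‖ρ‖²)`, and `gaugeDist = ‖ψ_{x₀} − 1‖² ≤ 2‖φ_{x₀}‖²`.

CONSEQUENCE for L1 (bus ym-idea-1 2026-08-29T22:01Z, source (γ)): the far-region cost of the Jacobian assembly becomes `e^{−cβ a₀²/(1+log H)⁴} =
e^{−cβ/(H⁴ polylog)}` against `e^{C H⁴ log β}` — window `H⁸·polylog ≤ β`, **`8θ < 1`**, matching ✓J4∞ (the radius condition `r·H² ≤ c₀` holds there: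
`r ≍ H²√(log β/β)`, `r H² ≍ H⁴ √(log β/β) ≪ 1` iff `8θ < 1`).

Everything proved; no definitions; Mathlib + tree only; standard axioms.  HONEST LABEL: a deterministic glue brick for the recorded lift L1 of the NEXT
rung U5 (LINE-20 ⟨stmt-QuantumFields-24336⟩, unstaffed, gated by the critic's N2/I23); the `ℓ^∞` re-assembly of T-S5.4J and the lifts L2–L5 are NOT
here; S5, U5, ⟨24004⟩ ⟨24335⟩ ⟨24336⟩ remain OPEN; no stub is closed by name; no crux, rung or summit is proved; **the Yang–Mills mass gap is NOT proved
by this file; no summit is proved by a line.**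
-/

set_option autoImplicit false

noncomputable section

open Matrix Finset Quaternion
open Literature.MathematicalPhysics.QuantumFieldTheory.AxialGauge (boxEdges)
open Literature.MathematicalPhysics.QuantumLattice (su2Quat norm_su2Quat gaugeTransformZd LGConfig ZdEdge)
open Literature.Probability.LatticeModels (Site dirichletMatrix zeroExtend zeroExtend_of_mem zeroExtend_of_not_mem mulVec_dirichletMatrix
  latticeLaplacianZd_def)
open Summit.QuantumFields.YangMills.Theorems.AllWindowsColdBoxBoxHighLine.LandauBall

namespace Summit.QuantumFields.YangMills.Theorems.AllWindowsColdBoxBoxHighLine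

open LandauBallCapacity

/-! ## The single-site coercivity with a logarithm -/

/-- ★★ **J5a′, gauge-ball form: single-site coercivity of `landauPhi` with `(1 + log H)⁴` in place of `H⁴`.**  There are `c₀ > 0` and `C ≥ 0` such
that for `H ≥ 1`, `0 ≤ r`, `r·H² ≤ c₀`, every configuration `U` and interior gauge transformations `g, g'` with `U^g` in lattice Landau gauge and
both `U^g`, `U^{g'}` having all cold-box links within defect `r²`:  `gaugeDist g g' x₀ ≤ C·(1 + log H)⁴ · landauPhi H (U^{g'})` at EVERY site `x₀`. -/
theorem landauBallCoercivity_site : ∃ c₀ C : ℝ, 0 < c₀ ∧ 0 ≤ C ∧ ∀ H : ℕ, 1 ≤ H → ∀ r : ℝ, 0 ≤ r → r * (H : ℝ) ^ 2 ≤ c₀ →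
    ∀ (U : LGConfig 4 SU2) (g g' : Site 4 → SU2), IsInteriorGauge H g → IsInteriorGauge H g' →
      (∀ e ∈ boxEdges 4 (2 * H + 1), linkDefect (gaugeTransformZd g U) e ≤ r ^ 2) →
      (∀ e ∈ boxEdges 4 (2 * H + 1), linkDefect (gaugeTransformZd g' U) e ≤ r ^ 2) →
      InLandauGauge H (gaugeTransformZd g U) →
        ∀ x₀ : Site 4, gaugeDist g g' x₀ ≤ C * (1 + Real.log H) ^ 4 * landauPhi H (gaugeTransformZd g' U) := by
  obtain ⟨c₀, c, hc₀, hc, hcoer⟩ := landauBallCoercivity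
  obtain ⟨C, hC, hcap⟩ := norm_sq_le_capacity_lap
  refine ⟨min c₀ (1 / 4), 4 * C * (1 + 144 / c), lt_min hc₀ (by norm_num), by positivity, ?_⟩
  intro H hH r hr hrH U g g' hg hg' hdg hdg' hLg x₀
  have hH1 : (1 : ℝ) ≤ H := by exact_mod_cast hH
  have hlog : 0 ≤ Real.log H := Real.log_nonneg hH1
  have hL4 : 0 ≤ (1 + Real.log H) ^ 4 := by positivity
  have hΦ0 : 0 ≤ landauPhi H (gaugeTransformZd g' U) := landauPhi_nonneg H _
  -- the radius regime: `r H ≤ c₀`, `r H ≤ 1/4`, `r² H⁴ ≤ 1/16`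
  have hrH2c : r * (H : ℝ) ^ 2 ≤ c₀ := hrH.trans (min_le_left _ _)
  have hrH2q : r * (H : ℝ) ^ 2 ≤ 1 / 4 := hrH.trans (min_le_right _ _)
  have hrHle : r * H ≤ r * (H : ℝ) ^ 2 := mul_le_mul_of_nonneg_left (by nlinarith) hr
  have hrHc : r * H ≤ c₀ := hrHle.trans hrH2c
  have hrH4 : r * H ≤ 1 / 4 := hrHle.trans hrH2q
  -- 4ℓ by name: `c · Σ gaugeDist ≤ H⁴ Φ`
  have hG := hcoer H hH r hr hrHc U g g' hg hg' hdg hdg' hLg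
  -- ✓4ℓ's letters
  set V : LGConfig 4 SU2 := gaugeTransformZd g U with hV
  set W : LGConfig 4 SU2 := gaugeTransformZd g' U with hW
  set h : Site 4 → SU2 := fun x => g' x * (g x)⁻¹ with hh
  have hh1 : ∀ x, x ∉ interiorSites H → h x = 1 := fun x hx => by simp [hh, hg x hx, hg' x hx]
  have hWh : ∀ e : ZdEdge 4, W e = h e.1 * V e * (h (e.1 + Pi.single e.2 1))⁻¹ := by
    intro e
    simp only [hW, hV, hh, gaugeTransformZd]
    group
  have hone : su2Quat (1 : SU2) = 1 := FemtoTransferGap.su2Quat_one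
  set ψ : Site 4 → ℍ := fun x => su2Quat (h x) with hψ
  have hψ1 : ∀ x, x ∉ interiorSites H → ψ x = 1 := fun x hx => by simp only [hψ, hh1 x hx, hone]
  have hnorm : ∀ x, ‖ψ x‖ = 1 := fun x => norm_su2Quat _
  have hqW : ∀ e : ZdEdge 4, su2Quat (W e) = ψ e.1 * su2Quat (V e) * star (ψ (e.1 + Pi.single e.2 1)) := by
    intro e; rw [hWh e, su2Quat_mul_mul_inv]
  have hVr : ∀ e ∈ boxEdges 4 (2 * H + 1), ‖su2Quat (V e) - 1‖ ≤ r := fun e he => norm_su2Quat_sub_one_le hr (hdg e he)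
  have hWr : ∀ e ∈ boxEdges 4 (2 * H + 1), ‖su2Quat (W e) - 1‖ ≤ r := fun e he => norm_su2Quat_sub_one_le hr (hdg' e he)
  have hedge : ∀ e ∈ boxEdges 4 (2 * H + 1), ‖ψ e.1 - ψ (e.1 + Pi.single e.2 1)‖ ≤ 2 * r := by
    intro e he
    have h1 := norm_sub_le_of_transform (su2Quat (V e)) (hnorm e.1) (hnorm (e.1 + Pi.single e.2 1))
    rw [← hqW e] at h1
    linarith [hVr e he, hWr e he]
  have hsup : ∀ x, ‖ψ x - 1‖ ≤ 4 * r * H := norm_sub_one_le_of_edges hr ψ hψ1 hedge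
  have hre : ∀ x, 0 ≤ (ψ x).re := fun x => by
    have h1 := one_sub_norm_le_re (ψ x)
    have h2 : 4 * r * (H : ℝ) ≤ 1 := by linarith
    linarith [hsup x]
  -- `gaugeDist = ‖ψ − 1‖²`
  have hgd : ∀ x, gaugeDist g g' x = ‖ψ x - 1‖ ^ 2 := fun x =>
    linkDefect_eq_norm_sq (fun _ => h x) ((0 : Site 4), (0 : Fin 4))
  -- the test field `φ = Im ψ`, the edge field `F`, the remainder `E`
  set φ : Site 4 → ℍ := fun x => (ψ x).im with hφ
  have hφ0 : ∀ x, x ∉ interiorSites H → φ x = 0 := fun x hx => by simp only [hφ, hψ1 x hx, Quaternion.im_one]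
  have hφre : ∀ x, (φ x).re = 0 := fun x => rfl
  set F : ZdEdge 4 → ℍ := fun e => (su2Quat (W e)).im - (su2Quat (V e)).im with hF
  set E : ZdEdge 4 → ℍ := fun e => F e - (φ e.1 - φ (e.1 + Pi.single e.2 1)) with hE
  -- per-edge remainder bound
  have hEe : ∀ e ∈ boxEdges 4 (2 * H + 1), ‖E e‖ ^ 2 ≤ 18 * r ^ 2 * (‖ψ e.1 - 1‖ ^ 2 + ‖ψ (e.1 + Pi.single e.2 1) - 1‖ ^ 2) := by
    intro e he
    have h1 := norm_sq_im_transform_sub_linear_le (V := su2Quat (V e)) (hnorm e.1) (hnorm (e.1 + Pi.single e.2 1)) (hVr e he) (hedge e he)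
    have hEq : E e = (ψ e.1 * su2Quat (V e) * star (ψ (e.1 + Pi.single e.2 1)) - su2Quat (V e)).im -
        ((ψ e.1).im - (ψ (e.1 + Pi.single e.2 1)).im) := by
      simp only [hE, hF, hφ, hqW e, im_sub]
    rw [hEq]
    exact h1
  -- Σ_e ‖E e‖² ≤ 144 r² Σ gaugeDist ≤ 144 r² H⁴ Φ / c
  have hEsum : ∑ e ∈ boxEdges 4 (2 * H + 1), ‖E e‖ ^ 2 ≤ 144 * r ^ 2 * ∑ x ∈ interiorSites H, gaugeDist g g' x := by
    have hmult := sum_edges_endpoints_le (H := H) (fun x => ‖ψ x - 1‖ ^ 2) (fun x => sq_nonneg _)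
      (fun x hx => by simp only [hψ1 x hx, sub_self, norm_zero]; ring)
    calc ∑ e ∈ boxEdges 4 (2 * H + 1), ‖E e‖ ^ 2
        ≤ ∑ e ∈ boxEdges 4 (2 * H + 1), 18 * r ^ 2 * (‖ψ e.1 - 1‖ ^ 2 + ‖ψ (e.1 + Pi.single e.2 1) - 1‖ ^ 2) := Finset.sum_le_sum hEe
      _ = 18 * r ^ 2 * ∑ e ∈ boxEdges 4 (2 * H + 1), (‖ψ e.1 - 1‖ ^ 2 + ‖ψ (e.1 + Pi.single e.2 1) - 1‖ ^ 2) := by rw [Finset.mul_sum]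
      _ ≤ 18 * r ^ 2 * (8 * ∑ x ∈ interiorSites H, ‖ψ x - 1‖ ^ 2) := mul_le_mul_of_nonneg_left hmult (by positivity)
      _ = 144 * r ^ 2 * ∑ x ∈ interiorSites H, gaugeDist g g' x := by
          rw [show (18 : ℝ) * r ^ 2 * (8 * ∑ x ∈ interiorSites H, ‖ψ x - 1‖ ^ 2) = 144 * r ^ 2 * ∑ x ∈ interiorSites H, ‖ψ x - 1‖ ^ 2 by ring]
          congr 1
          exact Finset.sum_congr rfl fun x _ => (hgd x).symm
  have hEsum' : ∑ e ∈ boxEdges 4 (2 * H + 1), ‖E e‖ ^ 2 ≤ 9 / c * landauPhi H W := by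
    have hG' : ∑ x ∈ interiorSites H, gaugeDist g g' x ≤ (H : ℝ) ^ 4 * landauPhi H W / c := by
      rw [le_div_iff₀ hc]; linarith [hG]
    have hr2H4 : r ^ 2 * (H : ℝ) ^ 4 ≤ 1 / 16 := by nlinarith [hrH2q, mul_nonneg hr (by positivity : (0 : ℝ) ≤ (H : ℝ) ^ 2)]
    calc ∑ e ∈ boxEdges 4 (2 * H + 1), ‖E e‖ ^ 2 ≤ 144 * r ^ 2 * ((H : ℝ) ^ 4 * landauPhi H W / c) :=
          hEsum.trans (mul_le_mul_of_nonneg_left hG' (by positivity))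
      _ = 144 * (r ^ 2 * (H : ℝ) ^ 4) * (landauPhi H W / c) := by ring
      _ ≤ 144 * (1 / 16) * (landauPhi H W / c) := by
          refine mul_le_mul_of_nonneg_right (mul_le_mul_of_nonneg_left hr2H4 (by norm_num)) (div_nonneg hΦ0 hc.le)
      _ = 9 / c * landauPhi H W := by ring
  -- the additive reading `L v = (0, v₀, −v₁, v₂)` and the site equation
  let imL : (Fin 3 → ℝ) →+ ℍ :=
    { toFun := fun v => ⟨0, v 0, -(v 1), v 2⟩
      map_zero' := by ext <;> simp
      map_add' := fun v w => by ext <;> simp; ring }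
  have himL : ∀ W' : SU2, (su2Quat W').im = imL (imVec W') := fun W' => LandauBallCoercive.im_su2Quat_eq_imVec W'
  have himLn : ∀ v : Fin 3 → ℝ, ‖imL v‖ ^ 2 = ∑ c : Fin 3, v c ^ 2 := fun v => by
    rw [LandauBallCoercive.norm_sq_of_re_eq_zero (show (imL v).re = 0 from rfl), Fin.sum_univ_three]
    show (v 0) ^ 2 + (-(v 1)) ^ 2 + (v 2) ^ 2 = _
    ring
  have hdiv : ∀ x ∈ interiorSites H, ∑ μ : Fin 4, (F (x, μ) - F (x - Pi.single μ 1, μ)) = -imL (divDefect W x) := by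
    intro x hx
    have h2 := sum_im_su2Quat_eq_of_inLandauGauge hLg hx
    have hLW : imL (divDefect W x) = ∑ μ : Fin 4, ((su2Quat (W (x - Pi.single μ 1, μ))).im - (su2Quat (W (x, μ))).im) := by
      rw [divDefect, map_sum]
      refine Finset.sum_congr rfl fun μ _ => ?_
      rw [map_sub, himL, himL]
    rw [hLW]
    simp only [hF, Finset.sum_sub_distrib] at h2 ⊢
    rw [h2]
    abel
  have hΦ : landauPhi H W = ∑ x ∈ interiorSites H, ‖imL (divDefect W x)‖ ^ 2 := by
    unfold landauPhi
    exact Finset.sum_congr rfl fun x _ => (himLn _).symm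
  -- site equation: `(−Δ_D φ)(x) = −L(div W x) − ρ(x)`
  set ρ : Site 4 → ℍ := fun x => ∑ μ : Fin 4, (E (x, μ) - E (x - Pi.single μ 1, μ)) with hρ
  have hsite : ∀ x ∈ interiorSites H,
      ∑ μ : Fin 4, ((φ x - φ (x + Pi.single μ 1)) - (φ (x - Pi.single μ 1) - φ x)) = -imL (divDefect W x) - ρ x := by
    intro x hx
    rw [← hdiv x hx, hρ, ← Finset.sum_sub_distrib]
    refine Finset.sum_congr rfl fun μ _ => ?_
    simp only [hE, sub_add_cancel]
    abel
  -- capacity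
  have hρsum : ∑ x ∈ interiorSites H, ‖ρ x‖ ^ 2 ≤ 16 * ∑ e ∈ boxEdges 4 (2 * H + 1), ‖E e‖ ^ 2 := sum_norm_div_sq_le E
  have hlapsum : ∑ x ∈ interiorSites H, ‖∑ μ : Fin 4, ((φ x - φ (x + Pi.single μ 1)) - (φ (x - Pi.single μ 1) - φ x))‖ ^ 2 ≤
      2 * landauPhi H W + 2 * ∑ x ∈ interiorSites H, ‖ρ x‖ ^ 2 := by
    rw [hΦ, Finset.mul_sum, Finset.mul_sum, ← Finset.sum_add_distrib]
    refine Finset.sum_le_sum fun x hx => ?_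
    rw [hsite x hx]
    have h1 : ‖-imL (divDefect W x) - ρ x‖ ≤ ‖imL (divDefect W x)‖ + ‖ρ x‖ := by
      calc ‖-imL (divDefect W x) - ρ x‖ ≤ ‖-imL (divDefect W x)‖ + ‖ρ x‖ := norm_sub_le _ _
        _ = ‖imL (divDefect W x)‖ + ‖ρ x‖ := by rw [norm_neg]
    have h0 : 0 ≤ ‖-imL (divDefect W x) - ρ x‖ := norm_nonneg _
    nlinarith [pow_le_pow_left₀ h0 h1 2, sq_nonneg (‖imL (divDefect W x)‖ - ‖ρ x‖)]
  -- conclude at an interior site; off the interior `gaugeDist = 0`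
  by_cases hx₀ : x₀ ∈ interiorSites H
  · have hcapx := hcap H hH φ hφ0 hφre x₀ hx₀
    have hφx : ‖φ x₀‖ ^ 2 ≤ C * (1 + Real.log H) ^ 4 * (2 * (1 + 144 / c) * landauPhi H W) := by
      refine hcapx.trans (mul_le_mul_of_nonneg_left ?_ (by positivity))
      calc _ ≤ 2 * landauPhi H W + 2 * ∑ x ∈ interiorSites H, ‖ρ x‖ ^ 2 := hlapsum
        _ ≤ 2 * landauPhi H W + 2 * (16 * (9 / c * landauPhi H W)) := by linarith [hρsum, hEsum']
        _ = 2 * (1 + 144 / c) * landauPhi H W := by ring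
    calc gaugeDist g g' x₀ = ‖ψ x₀ - 1‖ ^ 2 := hgd x₀
      _ ≤ 2 * ‖(ψ x₀).im‖ ^ 2 := norm_sub_one_sq_le (hnorm x₀) (hre x₀)
      _ = 2 * ‖φ x₀‖ ^ 2 := rfl
      _ ≤ 2 * (C * (1 + Real.log H) ^ 4 * (2 * (1 + 144 / c) * landauPhi H W)) := by linarith [hφx]
      _ = 4 * C * (1 + 144 / c) * (1 + Real.log H) ^ 4 * landauPhi H W := by ring
  · rw [hgd x₀, hψ1 x₀ hx₀, sub_self, norm_zero]
    have : 0 ≤ 4 * C * (1 + 144 / c) * (1 + Real.log H) ^ 4 * landauPhi H W := by positivity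
    simpa using this

/-! ## J5a′ in the letters of ✓`FarRegionPhiLowerBall` -/

open PauliRegions in
/-- ★★ **J5a′: the far-region lower bound on `landauPhi` with `(1 + log H)⁴` in place of `H⁴`** (ball condition read from the cut-off as in ✓J5a;
radius condition `r·H² ≤ c₀`): `c·‖A x₀‖² ≤ (1 + log H)⁴ · landauPhi H (V^{pauliGauge H A})` at every interior site `x₀`. -/
theorem farRegionPhiLowerBall_log : ∃ c₀ c : ℝ, 0 < c₀ ∧ 0 < c ∧ ∀ H : ℕ, 1 ≤ H → ∀ r : ℝ, 0 ≤ r → r * (H : ℝ) ^ 2 ≤ c₀ →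
    ∀ (V : LGConfig 4 SU2) (A : ↥(interiorSites H) → EuclideanSpace ℝ (Fin 3)),
      (∀ e ∈ boxEdges 4 (2 * H + 1), linkDefect V e ≤ r ^ 2) → InLandauGauge H V →
      (∀ e ∈ boxEdges 4 (2 * H + 1), linkDefect (gaugeTransformZd (pauliGauge H A) V) e < 4 * r ^ 2) →
      (∀ x, ‖A x‖ ≤ Real.pi) →
        ∀ x₀, c * ‖A x₀‖ ^ 2 ≤ (1 + Real.log H) ^ 4 * landauPhi H (gaugeTransformZd (pauliGauge H A) V) := by
  obtain ⟨c₀, C, hc₀, hC, hsite⟩ := landauBallCoercivity_site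
  refine ⟨c₀ / 2, (2 / Real.pi) ^ 2 / (C + 1), by positivity, by positivity, ?_⟩
  intro H hH r hr hrH V A hV hLV hW hAπ x₀
  have hr2 : 0 ≤ 2 * r := by positivity
  have hr2H : 2 * r * (H : ℝ) ^ 2 ≤ c₀ := by linarith
  have h1 : ∀ e ∈ boxEdges 4 (2 * H + 1), linkDefect (gaugeTransformZd (1 : Site 4 → SU2) V) e ≤ (2 * r) ^ 2 := by
    intro e he
    rw [gaugeTransformZd_one_eq_self]
    exact (hV e he).trans (by nlinarith)
  have h2 : ∀ e ∈ boxEdges 4 (2 * H + 1), linkDefect (gaugeTransformZd (pauliGauge H A) V) e ≤ (2 * r) ^ 2 := fun e he => by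
    have := hW e he; nlinarith
  have hL1 : InLandauGauge H (gaugeTransformZd (1 : Site 4 → SU2) V) := by rw [gaugeTransformZd_one_eq_self]; exact hLV
  have key := hsite H hH (2 * r) hr2 hr2H V 1 (pauliGauge H A) (isInteriorGauge_one H) (isInteriorGauge_extendGauge _) h1 h2 hL1 x₀
  have hx₀' := sq_norm_le_gaugeDist_pauliGauge A x₀ (hAπ x₀)
  have hΦ0 : 0 ≤ landauPhi H (gaugeTransformZd (pauliGauge H A) V) := landauPhi_nonneg H _
  have hL4 : 0 ≤ (1 + Real.log H) ^ 4 := pow_nonneg (add_nonneg zero_le_one (Real.log_nonneg (by exact_mod_cast hH))) 4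
  have hmain : (2 / Real.pi) ^ 2 * ‖A x₀‖ ^ 2 ≤ C * (1 + Real.log H) ^ 4 * landauPhi H (gaugeTransformZd (pauliGauge H A) V) :=
    hx₀'.trans key
  rw [div_mul_eq_mul_div, div_le_iff₀ (by positivity)]
  calc (2 / Real.pi) ^ 2 * ‖A x₀‖ ^ 2 ≤ C * (1 + Real.log H) ^ 4 * landauPhi H (gaugeTransformZd (pauliGauge H A) V) := hmain
    _ ≤ (1 + Real.log H) ^ 4 * landauPhi H (gaugeTransformZd (pauliGauge H A) V) * (C + 1) := by
        nlinarith [mul_nonneg hL4 hΦ0]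

end Summit.QuantumFields.YangMills.Theorems.AllWindowsColdBoxBoxHighLine

end
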